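import Literature.Barriers.AtomisticToContinuum.HardDiskLemma5Kernel
import Mathlib.MeasureTheory.Measure.Trim
import Mathlib.MeasureTheory.Function.AEEqOfLIntegral
import Mathlib.MeasureTheory.Measure.Decomposition.RadonNikodym
import Mathlib.MeasureTheory.Constructions.BorelSpace.Order
import HarnessLib

/-!
# Gibbs measures of the hard-disc model: convexity, tail conditioning, and
# "a Gibbs measure is determined by its restriction to the tail σ-algebra"
# (Friedli–Velenik 2017, Proposition 6.61; Georgii, Theorem 7.7; for Richthammer 2007, Lemma 5)

The structural facts about `𝒢_𝒳(U_hc, z)` (`IsGibbs z`) used in the proof of Richthammer's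
Lemma 5 (`Richthammer2007_lemma5_holds`), all proved from the DLR equation and the properness of
the specification (`exists_gibbsSpec`, `gibbsKernel_inter_preimage` of `HardDiskLemma5Kernel.lean`).
Tail events `T ∈ 𝓕_{𝒳,∞} = ⋂_m 𝓕_{𝒳,Λ_mᶜ}` are written `∀ m : ℕ, IsCylinderEvent (Λ_m)ᶜ T`, and
the tail σ-algebra itself as `⨅ m, MeasurableSpace.comap (e_{Λ_mᶜ}) 𝓕_𝒳` (no new definitions).

* `IsGibbs.midpoint` — `𝒢` is convex (`½(μ + ν) ∈ 𝒢`);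
* `IsGibbs.cond_tail` — conditioning on a tail event of positive probability stays in `𝒢`
  (the elementary direction of [FriedliVelenik2017, Prop. 6.61 (1)]: `1_A μ / μ(A) ∈ 𝒢(π)` for
  `A ∈ 𝓣_∞`, as used in the proof of Thm 6.58, `1 ⇒ 2`);
* `IsGibbs.exists_measurable_tail_withDensity_eq` — [FriedliVelenik2017, Prop. 6.61 (1)],
  forward direction: if `μ, λ ∈ 𝒢` and `μ ≪ λ` then `dμ/dλ` has a `𝓣_∞ = 𝓕_{𝒳,∞}`-measurable
  version. Printed proof: `f = λ(f | 𝓕_{Λᶜ})` a.s. for every `Λ` (from `t_Λ r_Λ (fλ) = fλ`, Lemma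
  6.60), then the backward martingale theorem; here the first step is done with the explicit version
  `f_Λ := γ_Λ f` (properness + DLR), and the limit is replaced by `limsup_m f_{Λ_m}`, which is
  `𝓣_∞`-measurable because `𝓕_{Λ_mᶜ}` decreases — no martingale convergence is needed;
* `IsGibbs.ext_of_forall_tail` — [FriedliVelenik2017, Prop. 6.61 (2)] / [Georgii2011, Thm 7.7]:
  two Gibbs measures that agree on `𝓣_∞` are equal (densities w.r.t. `½(μ+ν)`).

Generic measure theory proved on the way (no Gibbs structure): `measurable_limsup_of_antitone`
(a `limsup` along a decreasing filtration is measurable for its infimum) and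
`ae_eq_of_forall_setLIntegral_eq_of_le` (two `m`-measurable densities with equal integrals on
`m`-sets agree a.e., via `Measure.trim`).

## References

* T. Richthammer, *Translation-invariance of two-dimensional Gibbsian point processes*, Comm.
  Math. Phys. 274 (2007) 81–122, arXiv:0706.3637: §3.2 (p. 6), §3.3 (3.1) (p. 7), §4.3 (p. 10).
* S. Friedli, Y. Velenik, *Statistical Mechanics of Lattice Systems: a Concrete Mathematical
  Introduction*, CUP 2017, §6.8.1: Lemma 6.60, Proposition 6.61 and its proof, Theorem 6.58.
* H.-O. Georgii, *Gibbs Measures and Phase Transitions*, de Gruyter 1988/2011, Theorem 7.7 —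
  cited through [Richthammer2007, §4.3]; not re-read here.
-/

noncomputable section

open MeasureTheory Set ProbabilityTheory Filter
open scoped ENNReal

namespace Literature.Barriers.AtomisticToContinuum.HardDisk

open Literature.Analysis.FunctionSpaces

/-! ### Two generic lemmas on sub-σ-algebras -/

section Generic

variable {α : Type*}

/-- A `limsup` along `ℕ` of functions adapted to a *decreasing* sequence of σ-algebras
`m 0 ≥ m 1 ≥ ⋯` is measurable for their infimum `⨅ m n` (for each `k`, drop the first `k` terms).
[folklore] -/
theorem measurable_limsup_of_antitone (m : ℕ → MeasurableSpace α) (hm : Antitone m)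
    {f : ℕ → α → ℝ≥0∞} (hf : ∀ n, Measurable[m n] (f n)) :
    Measurable[⨅ n, m n] fun x => limsup (fun n => f n x) atTop := by
  have hk : ∀ k, Measurable[m k] fun x => limsup (fun n => f n x) atTop := by
    intro k
    have heq : (fun x => limsup (fun n => f n x) atTop) =
        fun x => limsup (fun n => f (n + k) x) atTop := by
      funext x
      exact (Filter.limsup_nat_add (fun n => f n x) k).symm
    rw [heq]
    letI : MeasurableSpace α := m k
    exact Measurable.limsup fun n => (hf (n + k)).mono (hm (Nat.le_add_left k n)) le_rfl
  intro s hs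
  exact MeasurableSpace.measurableSet_iInf.2 fun k => hk k hs

/-- Two `m`-measurable `ℝ≥0∞`-densities of a finite measure on `m0 ≥ m` with equal integrals over
all `m`-measurable sets agree almost everywhere (pass to `μ.trim`). [folklore] -/
theorem ae_eq_of_forall_setLIntegral_eq_of_le {m m0 : MeasurableSpace α} {μ : Measure α}
    [IsFiniteMeasure μ] (hm : m ≤ m0) {f g : α → ℝ≥0∞} (hf : Measurable[m] f) (hg : Measurable[m] g)
    (h : ∀ s, MeasurableSet[m] s → ∫⁻ x in s, f x ∂μ = ∫⁻ x in s, g x ∂μ) : f =ᵐ[μ] g := by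
  have key : f =ᵐ[μ.trim hm] g :=
    ae_eq_of_forall_setLIntegral_eq_of_sigmaFinite (μ := μ.trim hm) hf hg fun s hs _ => by
      rw [setLIntegral_trim hm hf hs, setLIntegral_trim hm hg hs]
      exact h s hs
  exact ae_eq_of_ae_eq_trim key

end Generic

/-! ### Convexity and tail conditioning -/

/-- **`𝒢` is convex**: the midpoint `½(μ + ν)` of two Gibbs measures is a Gibbs measure (the DLR
equation is linear in `μ`). [cite: FriedliVelenik2017, §6.8 (p. 302)] -/
theorem IsGibbs.midpoint {z : ℝ} {μ ν : Measure (PointConfig (EuclideanSpace ℝ (Fin 2)))} (hμ : IsGibbs z μ) (hν : IsGibbs z ν) :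
    IsGibbs z ((2 : ℝ≥0∞)⁻¹ • (μ + ν)) := by
  haveI := hμ.1
  haveI := hν.1
  refine ⟨⟨?_⟩, fun Λ hΛ hb A hA => ?_⟩
  · rw [Measure.smul_apply, Measure.add_apply, measure_univ, measure_univ, smul_eq_mul,
      one_add_one_eq_two, ENNReal.inv_mul_cancel two_ne_zero ENNReal.ofNat_ne_top]
  · rw [Measure.smul_apply, Measure.add_apply, lintegral_smul_measure, lintegral_add_measure,
      hμ.2 Λ hΛ hb A hA, hν.2 Λ hΛ hb A hA]

/-- **Conditioning on a tail event preserves the Gibbs property**: for `μ ∈ 𝒢`, a tail event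
`T ∈ 𝓕_{𝒳,∞}` with `μ(T) > 0`, the conditioned measure `μ(· | T)` is again in `𝒢` — since
`T ∈ 𝓕_{𝒳,Λᶜ}` for every bounded `Λ`, properness gives `γ_Λ(A ∩ T|Y) = 1_T(Y) γ_Λ(A|Y)`.
(The elementary direction of Friedli–Velenik Prop. 6.61 (1), used in Thm 6.58 `1 ⇒ 2`.)
[cite: FriedliVelenik2017, Prop. 6.61 (1) and proof of Thm 6.58 (§6.8.1)] -/
theorem IsGibbs.cond_tail {z : ℝ} {μ : Measure (PointConfig (EuclideanSpace ℝ (Fin 2)))} (hμ : IsGibbs z μ) {T : Set (PointConfig (EuclideanSpace ℝ (Fin 2)))}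
    (hT : ∀ m : ℕ, IsCylinderEvent (box (m : ℝ))ᶜ T) (h0 : μ T ≠ 0) :
    IsGibbs z ((μ T)⁻¹ • μ.restrict T) := by
  haveI := hμ.1
  refine ⟨⟨?_⟩, fun Λ hΛ hb A hA => ?_⟩
  · rw [Measure.smul_apply, Measure.restrict_apply_univ, smul_eq_mul,
      ENNReal.inv_mul_cancel h0 (measure_ne_top μ T)]
  · obtain ⟨C, -, rfl⟩ := MeasurableSpace.measurableSet_comap.1 (isCylinderEvent_compl_of_forall_box hT hb)
    have hTm : MeasurableSet (PointConfig.restrict Λᶜ ⁻¹' C) :=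
      measurableSet_of_forall_isCylinderEvent_compl_box hT
    rw [Measure.smul_apply, smul_eq_mul, Measure.restrict_apply hA, lintegral_smul_measure, smul_eq_mul]
    congr 1
    rw [hμ.2 Λ hΛ hb _ (hA.inter hTm)]
    simp_rw [gibbsKernel_inter_preimage]
    rw [← lintegral_indicator hTm]
    refine lintegral_congr fun Y => ?_
    by_cases hY : Y ∈ PointConfig.restrict Λᶜ ⁻¹' C
    · rw [indicator_of_mem hY, indicator_of_mem hY, Pi.one_apply, one_mul]
    · rw [indicator_of_notMem hY, indicator_of_notMem hY, zero_mul]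

/-! ### Friedli–Velenik, Proposition 6.61: tail-measurable densities; determination by the tail -/

/-- **Densities between Gibbs measures are tail-measurable** (Friedli–Velenik Prop. 6.61 (1),
forward direction; Georgii Thm 7.7): if `μ, λ ∈ 𝒢_𝒳(U_hc, z)` and `μ ≪ λ`, then `μ = f λ` for some
`𝓕_{𝒳,∞} = ⋂_m 𝓕_{𝒳,Λ_mᶜ}`-measurable `f ≥ 0`. Proof: for each box `Λ = Λ_m`, with `f₀ = dμ/dλ` and
`f_Λ(Y) := ∫ γ_Λ(dX|Y) f₀(X)` (a version of `λ(f₀ | 𝓕_{Λᶜ})`, a function of `Y_{Λᶜ}`), the DLR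
equations for `μ` and `λ` and properness give `μ(A) = ∫_A f_Λ dλ`, so `f₀ = f_Λ` `λ`-a.e.;
then `f := limsup_m f_{Λ_m}` is tail measurable and `= f₀` a.e.
[cite: FriedliVelenik2017, Prop. 6.61 (1) (§6.8.1)] -/
theorem IsGibbs.exists_measurable_tail_withDensity_eq {z : ℝ} {μ ρ : Measure (PointConfig (EuclideanSpace ℝ (Fin 2)))}
    (hμ : IsGibbs z μ) (hρ : IsGibbs z ρ) (hac : μ ≪ ρ) :
    ∃ f : PointConfig (EuclideanSpace ℝ (Fin 2)) → ℝ≥0∞,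
      Measurable[⨅ m : ℕ, MeasurableSpace.comap (PointConfig.restrict (box (m : ℝ))ᶜ)
        (PointConfig.instMeasurableSpace : MeasurableSpace (PointConfig (EuclideanSpace ℝ (Fin 2))))] f ∧
      ρ.withDensity f = μ := by
  haveI := hμ.1
  haveI := hρ.1
  set f₀ : PointConfig (EuclideanSpace ℝ (Fin 2)) → ℝ≥0∞ := μ.rnDeriv ρ with hf₀
  have hf₀m : Measurable f₀ := Measure.measurable_rnDeriv μ ρ
  have hμeq : ρ.withDensity f₀ = μ := Measure.withDensity_rnDeriv_eq μ ρ hac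
  -- Step 1: on each box, `f₀` agrees a.e. with an `𝓕_{Λ_mᶜ}`-measurable function
  have step : ∀ m : ℕ, ∃ g : PointConfig (EuclideanSpace ℝ (Fin 2)) → ℝ≥0∞,
      Measurable[MeasurableSpace.comap (PointConfig.restrict (box (m : ℝ))ᶜ)
        (PointConfig.instMeasurableSpace : MeasurableSpace (PointConfig (EuclideanSpace ℝ (Fin 2))))] g ∧ f₀ =ᵐ[ρ] g := by
    intro m
    have hΛ : MeasurableSet (box (m : ℝ)) := measurableSet_box _
    have hb : Bornology.IsBounded (box (m : ℝ)) := isBounded_box _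
    obtain ⟨κ, _, hκA, hκr, hκp, hκdlr⟩ := exists_gibbsSpec z hΛ hb
    set F : PointConfig (EuclideanSpace ℝ (Fin 2)) → ℝ≥0∞ := fun W => ∫⁻ X, f₀ X ∂(κ W) with hFdef
    have hF : Measurable F := by
      rw [hFdef]
      exact hf₀m.lintegral_kernel
    have hFr : ∀ Y, F (Y.restrict (box (m : ℝ))ᶜ) = F Y := fun Y => by
      rw [hFdef]
      dsimp only
      rw [hκr]
    have hFm' : Measurable (F ∘ PointConfig.restrict (box (m : ℝ))ᶜ) :=
      hF.comp (PointConfig.measurable_restrict hΛ.compl)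
    refine ⟨F ∘ PointConfig.restrict (box (m : ℝ))ᶜ, measurable_comp_restrict hF _, ?_⟩
    have hwd : ρ.withDensity (F ∘ PointConfig.restrict (box (m : ℝ))ᶜ) = μ := by
      ext A hA
      rw [withDensity_apply _ hA]
      have h1 : μ A = ∫⁻ Y, f₀ Y * gibbsKernel z (box (m : ℝ)) Y A ∂ρ := by
        rw [hμ.2 _ hΛ hb A hA, ← hμeq,
          lintegral_withDensity_eq_lintegral_mul _ hf₀m (measurable_gibbsKernel z hΛ hA)]
        rfl
      have h2 : ∫⁻ Y, f₀ Y * gibbsKernel z (box (m : ℝ)) Y A ∂ρ =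
          ∫⁻ Y, gibbsKernel z (box (m : ℝ)) Y A * F Y ∂ρ := by
        have hmeas : Measurable fun Y => f₀ Y * gibbsKernel z (box (m : ℝ)) Y A :=
          hf₀m.mul (measurable_gibbsKernel z hΛ hA)
        rw [hκdlr ρ hρ _ hmeas]
        refine lintegral_congr fun Y => ?_
        have key := hκp Y (fun W => gibbsKernel z (box (m : ℝ)) W A) f₀ (measurable_gibbsKernel z hΛ hA) hf₀m
        simp only [gibbsKernel_restrict_compl] at key
        simp_rw [mul_comm (f₀ _) _]
        rw [key, hFdef]
      have h3 : ∫⁻ X in A, (F ∘ PointConfig.restrict (box (m : ℝ))ᶜ) X ∂ρ =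
          ∫⁻ Y, gibbsKernel z (box (m : ℝ)) Y A * F Y ∂ρ := by
        rw [← lintegral_indicator hA, hκdlr ρ hρ _ (hFm'.indicator hA)]
        refine lintegral_congr fun Y => ?_
        have hind : ∀ X, A.indicator (F ∘ PointConfig.restrict (box (m : ℝ))ᶜ) X =
            F (X.restrict (box (m : ℝ))ᶜ) * A.indicator 1 X := fun X => by
          by_cases hX : X ∈ A
          · rw [indicator_of_mem hX, indicator_of_mem hX, Pi.one_apply, mul_one, Function.comp_apply]
          · rw [indicator_of_notMem hX, indicator_of_notMem hX, mul_zero]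
        simp_rw [hind]
        rw [hκp Y F _ hF (measurable_one.indicator hA), hFr, lintegral_indicator_one hA, hκA Y A hA,
          mul_comm]
      rw [h3, ← h2, ← h1]
    have heq : ρ.withDensity f₀ = ρ.withDensity (F ∘ PointConfig.restrict (box (m : ℝ))ᶜ) := by
      rw [hμeq, hwd]
    exact (withDensity_eq_iff_of_sigmaFinite hf₀m.aemeasurable hFm'.aemeasurable).1 heq
  -- Step 2: the limsup over boxes is tail-measurable and still a version of `f₀`
  choose g hgm hfg using step
  refine ⟨fun Y => limsup (fun m => g m Y) atTop, ?_, ?_⟩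
  · refine measurable_limsup_of_antitone
      (fun m : ℕ => MeasurableSpace.comap (PointConfig.restrict (box (m : ℝ))ᶜ)
        (PointConfig.instMeasurableSpace : MeasurableSpace (PointConfig (EuclideanSpace ℝ (Fin 2)))))
      (fun m n hmn => ?_) hgm
    exact fun D hD => IsCylinderEvent.mono (measurableSet_box _).compl
      (compl_subset_compl.2 (box_mono (by exact_mod_cast hmn))) hD
  · rw [← hμeq]
    refine withDensity_congr_ae ?_
    have hall : ∀ᵐ Y ∂ρ, ∀ m, f₀ Y = g m Y := ae_all_iff.2 hfg
    filter_upwards [hall] with Y hY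
    have hc : (fun m => g m Y) = fun _ => f₀ Y := funext fun m => (hY m).symm
    rw [hc, limsup_const]

/-- **A Gibbs measure is determined by its restriction to the tail σ-algebra**
(Friedli–Velenik Prop. 6.61 (2); Georgii Thm 7.7): `μ, ν ∈ 𝒢_𝒳(U_hc, z)` with `μ(T) = ν(T)` for
every tail event `T ∈ 𝓕_{𝒳,∞}` are equal. Proof as printed: `λ := ½(μ + ν) ∈ 𝒢`, `μ = fλ`,
`ν = gλ` with tail-measurable `f, g` (item (1)); `∫_T (f - g) dλ = 0` for tail `T` forces `f = g`
`λ`-a.e. [cite: FriedliVelenik2017, Prop. 6.61 (2) (§6.8.1)] -/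
theorem IsGibbs.ext_of_forall_tail {z : ℝ} {μ ν : Measure (PointConfig (EuclideanSpace ℝ (Fin 2)))} (hμ : IsGibbs z μ)
    (hν : IsGibbs z ν)
    (h : ∀ T : Set (PointConfig (EuclideanSpace ℝ (Fin 2))), (∀ m : ℕ, IsCylinderEvent (box (m : ℝ))ᶜ T) → μ T = ν T) :
    μ = ν := by
  haveI := hμ.1
  haveI := hν.1
  set ρ : Measure (PointConfig (EuclideanSpace ℝ (Fin 2))) := (2 : ℝ≥0∞)⁻¹ • (μ + ν) with hρdef
  have hρ : IsGibbs z ρ := hμ.midpoint hν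
  haveI := hρ.1
  have hac : ∀ {κ : Measure (PointConfig (EuclideanSpace ℝ (Fin 2)))}, κ ≤ μ + ν → κ ≪ ρ := by
    intro κ hκ
    refine Measure.AbsolutelyContinuous.mk fun s _ h0 => ?_
    rw [hρdef, Measure.smul_apply, smul_eq_mul, mul_eq_zero] at h0
    rcases h0 with h0 | h0
    · exact absurd h0 (ENNReal.inv_ne_zero.2 ENNReal.ofNat_ne_top)
    · exact le_antisymm ((Measure.le_iff'.1 hκ s).trans h0.le) bot_le
  obtain ⟨f, hf, hfμ⟩ := hμ.exists_measurable_tail_withDensity_eq hρ (hac (Measure.le_add_right le_rfl))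
  obtain ⟨g, hg, hgν⟩ := hν.exists_measurable_tail_withDensity_eq hρ (hac (Measure.le_add_left le_rfl))
  have hfg : f =ᵐ[ρ] g := by
    refine ae_eq_of_forall_setLIntegral_eq_of_le iInf_comap_restrict_compl_box_le hf hg fun T hT => ?_
    have hT' : ∀ m : ℕ, IsCylinderEvent (box (m : ℝ))ᶜ T := MeasurableSpace.measurableSet_iInf.1 hT
    have hTm : MeasurableSet T := measurableSet_of_forall_isCylinderEvent_compl_box hT'
    rw [← withDensity_apply f hTm, ← withDensity_apply g hTm, hfμ, hgν]
    exact h T hT'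
  calc μ = ρ.withDensity f := hfμ.symm
    _ = ρ.withDensity g := withDensity_congr_ae hfg
    _ = ν := hgν

end Literature.Barriers.AtomisticToContinuum.HardDisk

end
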